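import Summits.HodgeConjecture.HodgeConjecture.Theorems.Ring2WeilCoverageCMFieldNormWitnesses
import HarnessLib

/-!
# Weil-type components over quartic CM fields, VIII (part A): the ROW STRUCTURE of the integer classes
# `n ≤ 40` — which discriminant classes label the SAME component (generic §0; `ℚ(ζ₈)`, `ℚ(ζ₁₂)`)

research route conditional on HC_CM; not a corollary; Q11.4-sentence-2 already refuted in dim ≥ 3. Cell
`pub-hodge-ring2`, seat `ring2-b03` (gen 50); kernel form of the `T`-set column of the Weil-type family-coverage
census `HOME/WEIL-FAMILY-COVERAGE.md` §b03.5 (operator priority5 2026-08-22T11:46:08Z). For a quartic CM field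
`E = F(√σ)`, `F = ℚ[S]/(R)`, `R = S² + pS + q` (Deligne's carriers `Deligne1982/WeilTypeCMDiscriminant`), the
components `W8.E.δ` of the `(E, 4)`-Weil locus at `g = 8` are indexed by `δ ∈ F^×/Nm_{E/F}(E^×)`
(`cmNormResidueGroup R`; Deligne §4 (1), Lemma 4.6; Landherr). Gens 46–49 decided in the kernel, for the seven
census fields and every `1 ≤ n ≤ 40`, WHETHER `[n]` is the split class (`X_table`, `Ring2WeilCoverageCMFieldTables*`).
This part VIII decides the finer question WHICH `n` LABEL THE SAME COMPONENT: per field,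

* `X_rowMap`: `[n] = [r(n)]` for the displayed graph of the row map `r` (`r(n)` = least positive integer on the
  row of `[n]`; one norm witness `(A + Bσ)² - σ(C + Dσ)² = n·r(n)·m²` per entry: `[n·r(n)] = [1] ⇒ [n] = [r(n)]`,
  every class having order `≤ 2`, §0);
* `X_reps_pairwise_ne`: the classes of the representatives are pairwise distinct (one obstruction certificate of
  gens 46–48 for each product `r₁r₂`: `[r₁r₂] ≠ [1] ⇒ [r₁] ≠ [r₂]`);
* `X_mk_eq_mk_iff_sameRow`: hence `[n₁] = [n₂] ↔ r(n₁) = r(n₂)` for all `1 ≤ n₁, n₂ ≤ 40` — the 40 integer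
  classes lie on exactly `N_E` components (`N_E = 4, 3` here; part B: `ℚ(√-3,√5)` 3, `ℚ(i,√5)` 4; part C:
  `ℚ(√-(2+√2))` 12; part D: `ℚ(ζ₅)` 17; part E: `ℚ(√-(3+√2))` 10).

The graphs agree with the `T`-sets (finite even sets of non-split places) computed in census §b03.5 by PARI
`nfhilbert` and the disjoint stdlib code (×2 by ring2-b06). No named fact, no definition, no `sorry`; nothing about
the Hodge conjecture is asserted: the theorems say which discriminant classes index the same Weil-type component
(Deligne Cor. 4.2 / Landherr), whose general member is OPEN on every row (census §b03.2).
References: [Deligne1982HodgeCycles] §4 p. 30 (1), Cor. 4.2, Lemma 4.6; [Landherr1936HermitianForms]. -/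

noncomputable section

set_option linter.dupNamespace false

open Polynomial

namespace Summit.HodgeConjecture.HodgeConjecture.Ring2.WeilCoverageCM

open Literature.AlgebraicGeometry.Deligne1982
open Literature.AlgebraicGeometry.HodgeTheory (splitDiscriminantClassCM)

/-! ### §0 Generic: classes have order two — same row / different rows from the product class -/

section Generic

variable {R : Polynomial ℤ} [Fact (Irreducible (realPolyQ R))] [Fact (Irreducible (cmPolyQ R))]

/-- **Same row from a norm witness for the product**: `[uv] = [1] ⇒ [u] = [v]` in `F^×/Nm_{E/F}(E^×)` (every
class has order `≤ 2`: `u⁻¹v = (u⁻¹)²·(uv)` and squares are norms, `[E:F] = 2`).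
[cite: Deligne1982HodgeCycles, §4 p. 30 (1) and Cor. 4.2] -/
theorem mk_eq_mk_of_mk_mul_eq_split (u v : (realField R)ˣ)
    (h : (QuotientGroup.mk (u * v) : cmNormResidueGroup R) = splitDiscriminantClassCM R 2) :
    (QuotientGroup.mk u : cmNormResidueGroup R) = QuotientGroup.mk v := by
  rw [splitDiscriminantClassCM_two_eq_one, QuotientGroup.eq_one_iff] at h
  rw [QuotientGroup.eq]
  have key : (u⁻¹) ^ 2 * (u * v) = u⁻¹ * v := by rw [sq, mul_assoc, inv_mul_cancel_left]
  rw [← key]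
  exact mul_mem (sq_mem_normUnitsSubgroup_cmField u⁻¹) h

/-- **Different rows from an obstruction for the product**: `[uv] ≠ [1] ⇒ [u] ≠ [v]` in `F^×/Nm_{E/F}(E^×)`
(`uv = u²·(u⁻¹v)`). [cite: Deligne1982HodgeCycles, §4 p. 30 (1) and Cor. 4.2] -/
theorem mk_ne_mk_of_mk_mul_ne_split (u v : (realField R)ˣ)
    (h : (QuotientGroup.mk (u * v) : cmNormResidueGroup R) ≠ splitDiscriminantClassCM R 2) :
    (QuotientGroup.mk u : cmNormResidueGroup R) ≠ QuotientGroup.mk v := by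
  intro huv
  apply h
  rw [splitDiscriminantClassCM_two_eq_one, QuotientGroup.eq_one_iff]
  rw [QuotientGroup.eq] at huv
  have key : u ^ 2 * (u⁻¹ * v) = u * v := by rw [sq, mul_assoc, mul_inv_cancel_left]
  rw [← key]
  exact mul_mem (sq_mem_normUnitsSubgroup_cmField u) huv

omit [Fact (Irreducible (cmPolyQ R))] in
/-- `F = ℚ[S]/(R)` has characteristic zero: a positive integer is a unit of `F`. [folklore] -/
theorem natCast_ne_zero_realField (r : ℕ) (hr : 1 ≤ r) : (r : realField R) ≠ 0 := by
  haveI : CharZero (realField R) :=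
    charZero_of_injective_algebraMap (algebraMap ℚ (realField R)).injective
  exact Nat.cast_ne_zero.2 (by omega)

omit [Fact (Irreducible (cmPolyQ R))] in
/-- **Row structure from a row map and pairwise distinct representatives.** If `G ⊂ ℕ × ℕ` is the graph of a
row map (`(n, r) ∈ G ⇒ [n] = [r]`) with values in a set `Reps` of positive integers whose classes are pairwise
distinct, then for `(n₁, r₁), (n₂, r₂) ∈ G`: `[n₁] = [n₂] ↔ r₁ = r₂`. [folklore] -/
theorem mk_eq_mk_iff_of_rowMap (G : Finset (ℕ × ℕ)) (Reps : Finset ℕ)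
    (hrow : ∀ n r : ℕ, (n, r) ∈ G → ∀ u v : (realField R)ˣ, (u : realField R) = n → (v : realField R) = r →
      (QuotientGroup.mk u : cmNormResidueGroup R) = QuotientGroup.mk v)
    (hne : ∀ r₁ r₂ : ℕ, r₁ ∈ Reps → r₂ ∈ Reps → r₁ < r₂ → ∀ u v : (realField R)ˣ, (u : realField R) = r₁ →
      (v : realField R) = r₂ → (QuotientGroup.mk u : cmNormResidueGroup R) ≠ QuotientGroup.mk v)
    (hG : ∀ nr ∈ G, nr.2 ∈ Reps ∧ 1 ≤ nr.2)
    {n₁ r₁ n₂ r₂ : ℕ} (h₁ : (n₁, r₁) ∈ G) (h₂ : (n₂, r₂) ∈ G) (u v : (realField R)ˣ)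
    (hu : (u : realField R) = n₁) (hv : (v : realField R) = n₂) :
    (QuotientGroup.mk u : cmNormResidueGroup R) = QuotientGroup.mk v ↔ r₁ = r₂ := by
  obtain ⟨hr₁, h1⟩ := hG _ h₁
  obtain ⟨hr₂, h2⟩ := hG _ h₂
  set w₁ : (realField R)ˣ := Units.mk0 (r₁ : realField R) (natCast_ne_zero_realField r₁ h1) with hw₁
  set w₂ : (realField R)ˣ := Units.mk0 (r₂ : realField R) (natCast_ne_zero_realField r₂ h2) with hw₂
  have e₁ := hrow n₁ r₁ h₁ u w₁ hu (Units.val_mk0 _)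
  have e₂ := hrow n₂ r₂ h₂ v w₂ hv (Units.val_mk0 _)
  constructor
  · intro huv
    by_contra hne'
    rcases lt_or_gt_of_ne hne' with hlt | hgt
    · exact hne r₁ r₂ hr₁ hr₂ hlt w₁ w₂ (Units.val_mk0 _) (Units.val_mk0 _) (by rw [← e₁, huv, e₂])
    · exact hne r₂ r₁ hr₂ hr₁ hgt w₂ w₁ (Units.val_mk0 _) (Units.val_mk0 _) (by rw [← e₂, ← huv, e₁])
  · rintro rfl
    have hw : w₁ = w₂ := Units.ext (by simp only [hw₁, hw₂, Units.val_mk0])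
    rw [e₁, hw, ← e₂]

end Generic

/-! ### `E = ℚ(ζ₈) = ℚ(i,√2)`, `R = S² + 6S + 1`: 4 rows among `1 ≤ n ≤ 40` — representatives `[1, 7, 23, 31]` -/

section Zeta8

variable {R : Polynomial ℤ} (hR : R = X ^ 2 + C 6 * X + C 1) [Fact (Irreducible (realPolyQ R))]
include hR

/-- **ROW MAP for `E = ℚ(ζ₈) = ℚ(i,√2)` (`R = S² + 6S + 1`), `1 ≤ n ≤ 40`: `[n] = [r(n)]` in `F^×/Nm_{E/F}(E^×)`,
`r(n)` = the least positive integer on the row of `[n]`** — the displayed set is the graph of `r` (split entries `r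
= 1`; non-split rows: [7] ∋ 7, 14, 21, 28, 35; [23] ∋ 23; [31] ∋ 31). Each case is a norm witness `(A + Bσ)² - σ(C +
Dσ)² = n·r(n)·m²` (`[n·r(n)] = [1] ⇒ [n] = [r(n)]`), or `u = v`. Agrees with the `T`-sets of census §b03.5 (PARI +
stdlib ×2 + ring2-b06's third code). [cite: Deligne1982HodgeCycles, §4 p. 30 (1) and Cor. 4.2] -/
theorem zeta8_rowMap (n r : ℕ)
    (h : (n, r) ∈ (
      {(1, 1), (2, 1), (3, 1), (4, 1), (5, 1), (6, 1), (7, 7), (8, 1), (9, 1), (10, 1), (11, 1), (12, 1), (13,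
       1), (14, 7), (15, 1), (16, 1), (17, 1), (18, 1), (19, 1), (20, 1), (21, 7), (22, 1), (23, 23), (24, 1),
       (25, 1), (26, 1), (27, 1), (28, 7), (29, 1), (30, 1), (31, 31), (32, 1), (33, 1), (34, 1), (35, 7),
       (36, 1), (37, 1), (38, 1), (39, 1), (40, 1)} : Finset (ℕ × ℕ)))
    (u v : (realField R)ˣ) (hu : (u : realField R) = n) (hv : (v : realField R) = r) :
    (QuotientGroup.mk u : cmNormResidueGroup R) = QuotientGroup.mk v := by
  haveI := fact_irreducible_cmPolyQ_of_pos hR (by norm_num) (by norm_num) disc_not_sq_six_one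
  simp only [Finset.mem_insert, Finset.mem_singleton, Prod.mk.injEq] at h
  rcases h with ⟨rfl, rfl⟩ | ⟨rfl, rfl⟩ | ⟨rfl, rfl⟩ | ⟨rfl, rfl⟩ | ⟨rfl, rfl⟩ | ⟨rfl, rfl⟩ | ⟨rfl, rfl⟩ | ⟨rfl, rfl⟩ | ⟨rfl, rfl⟩ | ⟨rfl, rfl⟩ |
    ⟨rfl, rfl⟩ | ⟨rfl, rfl⟩ | ⟨rfl, rfl⟩ | ⟨rfl, rfl⟩ | ⟨rfl, rfl⟩ | ⟨rfl, rfl⟩ | ⟨rfl, rfl⟩ | ⟨rfl, rfl⟩ | ⟨rfl, rfl⟩ | ⟨rfl, rfl⟩ |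
    ⟨rfl, rfl⟩ | ⟨rfl, rfl⟩ | ⟨rfl, rfl⟩ | ⟨rfl, rfl⟩ | ⟨rfl, rfl⟩ | ⟨rfl, rfl⟩ | ⟨rfl, rfl⟩ | ⟨rfl, rfl⟩ | ⟨rfl, rfl⟩ | ⟨rfl, rfl⟩ |
    ⟨rfl, rfl⟩ | ⟨rfl, rfl⟩ | ⟨rfl, rfl⟩ | ⟨rfl, rfl⟩ | ⟨rfl, rfl⟩ | ⟨rfl, rfl⟩ | ⟨rfl, rfl⟩ | ⟨rfl, rfl⟩ | ⟨rfl, rfl⟩ | ⟨rfl, rfl⟩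
  · rw [Units.ext (hu.trans hv.symm : (u : realField R) = v)]
  · exact mk_eq_mk_of_mk_mul_eq_split u v (mk_eq_splitDiscriminantClassCM_two_of_coords_of_pos hR (by norm_num) (by norm_num)
      disc_not_sq_six_one 2 3 1 0 0 2 two_ne_zero (by norm_num) (by norm_num) (u * v) (by rw [Units.val_mul, hu, hv]; norm_num))
  · exact mk_eq_mk_of_mk_mul_eq_split u v (mk_eq_splitDiscriminantClassCM_two_of_coords_of_pos hR (by norm_num) (by norm_num)
      disc_not_sq_six_one 3 3 1 5 1 2 two_ne_zero (by norm_num) (by norm_num) (u * v) (by rw [Units.val_mul, hu, hv]; norm_num))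
  · exact mk_eq_mk_of_mk_mul_eq_split u v (mk_eq_splitDiscriminantClassCM_two_of_coords_of_pos hR (by norm_num) (by norm_num)
      disc_not_sq_six_one 4 2 0 0 0 1 one_ne_zero (by norm_num) (by norm_num) (u * v) (by rw [Units.val_mul, hu, hv]; norm_num))
  · exact mk_eq_mk_of_mk_mul_eq_split u v (mk_eq_splitDiscriminantClassCM_two_of_coords_of_pos hR (by norm_num) (by norm_num)
      disc_not_sq_six_one 5 1 0 5 1 1 one_ne_zero (by norm_num) (by norm_num) (u * v) (by rw [Units.val_mul, hu, hv]; norm_num))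
  · exact mk_eq_mk_of_mk_mul_eq_split u v (mk_eq_splitDiscriminantClassCM_two_of_coords_of_pos hR (by norm_num) (by norm_num)
      disc_not_sq_six_one 6 5 1 2 0 2 two_ne_zero (by norm_num) (by norm_num) (u * v) (by rw [Units.val_mul, hu, hv]; norm_num))
  · rw [Units.ext (hu.trans hv.symm : (u : realField R) = v)]
  · exact mk_eq_mk_of_mk_mul_eq_split u v (mk_eq_splitDiscriminantClassCM_two_of_coords_of_pos hR (by norm_num) (by norm_num)
      disc_not_sq_six_one 8 3 1 0 0 1 one_ne_zero (by norm_num) (by norm_num) (u * v) (by rw [Units.val_mul, hu, hv]; norm_num))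
  · exact mk_eq_mk_of_mk_mul_eq_split u v (mk_eq_splitDiscriminantClassCM_two_of_coords_of_pos hR (by norm_num) (by norm_num)
      disc_not_sq_six_one 9 3 0 0 0 1 one_ne_zero (by norm_num) (by norm_num) (u * v) (by rw [Units.val_mul, hu, hv]; norm_num))
  · exact mk_eq_mk_of_mk_mul_eq_split u v (mk_eq_splitDiscriminantClassCM_two_of_coords_of_pos hR (by norm_num) (by norm_num)
      disc_not_sq_six_one 10 6 0 5 1 2 two_ne_zero (by norm_num) (by norm_num) (u * v) (by rw [Units.val_mul, hu, hv]; norm_num))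
  · exact mk_eq_mk_of_mk_mul_eq_split u v (mk_eq_splitDiscriminantClassCM_two_of_coords_of_pos hR (by norm_num) (by norm_num)
      disc_not_sq_six_one 11 6 0 7 1 2 two_ne_zero (by norm_num) (by norm_num) (u * v) (by rw [Units.val_mul, hu, hv]; norm_num))
  · exact mk_eq_mk_of_mk_mul_eq_split u v (mk_eq_splitDiscriminantClassCM_two_of_coords_of_pos hR (by norm_num) (by norm_num)
      disc_not_sq_six_one 12 3 1 5 1 1 one_ne_zero (by norm_num) (by norm_num) (u * v) (by rw [Units.val_mul, hu, hv]; norm_num))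
  · exact mk_eq_mk_of_mk_mul_eq_split u v (mk_eq_splitDiscriminantClassCM_two_of_coords_of_pos hR (by norm_num) (by norm_num)
      disc_not_sq_six_one 13 3 0 5 1 1 one_ne_zero (by norm_num) (by norm_num) (u * v) (by rw [Units.val_mul, hu, hv]; norm_num))
  · exact mk_eq_mk_of_mk_mul_eq_split u v (mk_eq_splitDiscriminantClassCM_two_of_coords_of_pos hR (by norm_num) (by norm_num)
      disc_not_sq_six_one 98 21 7 0 0 2 two_ne_zero (by norm_num) (by norm_num) (u * v) (by rw [Units.val_mul, hu, hv]; norm_num))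
  · exact mk_eq_mk_of_mk_mul_eq_split u v (mk_eq_splitDiscriminantClassCM_two_of_coords_of_pos hR (by norm_num) (by norm_num)
      disc_not_sq_six_one 15 8 2 3 1 2 two_ne_zero (by norm_num) (by norm_num) (u * v) (by rw [Units.val_mul, hu, hv]; norm_num))
  · exact mk_eq_mk_of_mk_mul_eq_split u v (mk_eq_splitDiscriminantClassCM_two_of_coords_of_pos hR (by norm_num) (by norm_num)
      disc_not_sq_six_one 16 4 0 0 0 1 one_ne_zero (by norm_num) (by norm_num) (u * v) (by rw [Units.val_mul, hu, hv]; norm_num))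
  · exact mk_eq_mk_of_mk_mul_eq_split u v (mk_eq_splitDiscriminantClassCM_two_of_coords_of_pos hR (by norm_num) (by norm_num)
      disc_not_sq_six_one 17 3 0 7 1 1 one_ne_zero (by norm_num) (by norm_num) (u * v) (by rw [Units.val_mul, hu, hv]; norm_num))
  · exact mk_eq_mk_of_mk_mul_eq_split u v (mk_eq_splitDiscriminantClassCM_two_of_coords_of_pos hR (by norm_num) (by norm_num)
      disc_not_sq_six_one 18 8 0 7 1 2 two_ne_zero (by norm_num) (by norm_num) (u * v) (by rw [Units.val_mul, hu, hv]; norm_num))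
  · exact mk_eq_mk_of_mk_mul_eq_split u v (mk_eq_splitDiscriminantClassCM_two_of_coords_of_pos hR (by norm_num) (by norm_num)
      disc_not_sq_six_one 19 9 3 5 1 2 two_ne_zero (by norm_num) (by norm_num) (u * v) (by rw [Units.val_mul, hu, hv]; norm_num))
  · exact mk_eq_mk_of_mk_mul_eq_split u v (mk_eq_splitDiscriminantClassCM_two_of_coords_of_pos hR (by norm_num) (by norm_num)
      disc_not_sq_six_one 20 4 0 5 1 1 one_ne_zero (by norm_num) (by norm_num) (u * v) (by rw [Units.val_mul, hu, hv]; norm_num))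
  · exact mk_eq_mk_of_mk_mul_eq_split u v (mk_eq_splitDiscriminantClassCM_two_of_coords_of_pos hR (by norm_num) (by norm_num)
      disc_not_sq_six_one 147 21 7 35 7 2 two_ne_zero (by norm_num) (by norm_num) (u * v) (by rw [Units.val_mul, hu, hv]; norm_num))
  · exact mk_eq_mk_of_mk_mul_eq_split u v (mk_eq_splitDiscriminantClassCM_two_of_coords_of_pos hR (by norm_num) (by norm_num)
      disc_not_sq_six_one 22 9 1 8 2 2 two_ne_zero (by norm_num) (by norm_num) (u * v) (by rw [Units.val_mul, hu, hv]; norm_num))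
  · rw [Units.ext (hu.trans hv.symm : (u : realField R) = v)]
  · exact mk_eq_mk_of_mk_mul_eq_split u v (mk_eq_splitDiscriminantClassCM_two_of_coords_of_pos hR (by norm_num) (by norm_num)
      disc_not_sq_six_one 24 5 1 2 0 1 one_ne_zero (by norm_num) (by norm_num) (u * v) (by rw [Units.val_mul, hu, hv]; norm_num))
  · exact mk_eq_mk_of_mk_mul_eq_split u v (mk_eq_splitDiscriminantClassCM_two_of_coords_of_pos hR (by norm_num) (by norm_num)
      disc_not_sq_six_one 25 5 0 0 0 1 one_ne_zero (by norm_num) (by norm_num) (u * v) (by rw [Units.val_mul, hu, hv]; norm_num))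
  · exact mk_eq_mk_of_mk_mul_eq_split u v (mk_eq_splitDiscriminantClassCM_two_of_coords_of_pos hR (by norm_num) (by norm_num)
      disc_not_sq_six_one 26 10 0 5 1 2 two_ne_zero (by norm_num) (by norm_num) (u * v) (by rw [Units.val_mul, hu, hv]; norm_num))
  · exact mk_eq_mk_of_mk_mul_eq_split u v (mk_eq_splitDiscriminantClassCM_two_of_coords_of_pos hR (by norm_num) (by norm_num)
      disc_not_sq_six_one 27 10 0 7 1 2 two_ne_zero (by norm_num) (by norm_num) (u * v) (by rw [Units.val_mul, hu, hv]; norm_num))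
  · exact mk_eq_mk_of_mk_mul_eq_split u v (mk_eq_splitDiscriminantClassCM_two_of_coords_of_pos hR (by norm_num) (by norm_num)
      disc_not_sq_six_one 196 14 0 0 0 1 one_ne_zero (by norm_num) (by norm_num) (u * v) (by rw [Units.val_mul, hu, hv]; norm_num))
  · exact mk_eq_mk_of_mk_mul_eq_split u v (mk_eq_splitDiscriminantClassCM_two_of_coords_of_pos hR (by norm_num) (by norm_num)
      disc_not_sq_six_one 29 5 0 5 1 1 one_ne_zero (by norm_num) (by norm_num) (u * v) (by rw [Units.val_mul, hu, hv]; norm_num))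
  · exact mk_eq_mk_of_mk_mul_eq_split u v (mk_eq_splitDiscriminantClassCM_two_of_coords_of_pos hR (by norm_num) (by norm_num)
      disc_not_sq_six_one 30 11 1 4 0 2 two_ne_zero (by norm_num) (by norm_num) (u * v) (by rw [Units.val_mul, hu, hv]; norm_num))
  · rw [Units.ext (hu.trans hv.symm : (u : realField R) = v)]
  · exact mk_eq_mk_of_mk_mul_eq_split u v (mk_eq_splitDiscriminantClassCM_two_of_coords_of_pos hR (by norm_num) (by norm_num)
      disc_not_sq_six_one 32 6 2 0 0 1 one_ne_zero (by norm_num) (by norm_num) (u * v) (by rw [Units.val_mul, hu, hv]; norm_num))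
  · exact mk_eq_mk_of_mk_mul_eq_split u v (mk_eq_splitDiscriminantClassCM_two_of_coords_of_pos hR (by norm_num) (by norm_num)
      disc_not_sq_six_one 33 5 0 7 1 1 one_ne_zero (by norm_num) (by norm_num) (u * v) (by rw [Units.val_mul, hu, hv]; norm_num))
  · exact mk_eq_mk_of_mk_mul_eq_split u v (mk_eq_splitDiscriminantClassCM_two_of_coords_of_pos hR (by norm_num) (by norm_num)
      disc_not_sq_six_one 34 12 2 1 1 2 two_ne_zero (by norm_num) (by norm_num) (u * v) (by rw [Units.val_mul, hu, hv]; norm_num))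
  · exact mk_eq_mk_of_mk_mul_eq_split u v (mk_eq_splitDiscriminantClassCM_two_of_coords_of_pos hR (by norm_num) (by norm_num)
      disc_not_sq_six_one 245 7 0 35 7 1 one_ne_zero (by norm_num) (by norm_num) (u * v) (by rw [Units.val_mul, hu, hv]; norm_num))
  · exact mk_eq_mk_of_mk_mul_eq_split u v (mk_eq_splitDiscriminantClassCM_two_of_coords_of_pos hR (by norm_num) (by norm_num)
      disc_not_sq_six_one 36 6 0 0 0 1 one_ne_zero (by norm_num) (by norm_num) (u * v) (by rw [Units.val_mul, hu, hv]; norm_num))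
  · exact mk_eq_mk_of_mk_mul_eq_split u v (mk_eq_splitDiscriminantClassCM_two_of_coords_of_pos hR (by norm_num) (by norm_num)
      disc_not_sq_six_one 37 12 0 5 1 2 two_ne_zero (by norm_num) (by norm_num) (u * v) (by rw [Units.val_mul, hu, hv]; norm_num))
  · exact mk_eq_mk_of_mk_mul_eq_split u v (mk_eq_splitDiscriminantClassCM_two_of_coords_of_pos hR (by norm_num) (by norm_num)
      disc_not_sq_six_one 38 12 0 7 1 2 two_ne_zero (by norm_num) (by norm_num) (u * v) (by rw [Units.val_mul, hu, hv]; norm_num))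
  · exact mk_eq_mk_of_mk_mul_eq_split u v (mk_eq_splitDiscriminantClassCM_two_of_coords_of_pos hR (by norm_num) (by norm_num)
      disc_not_sq_six_one 39 12 2 11 1 2 two_ne_zero (by norm_num) (by norm_num) (u * v) (by rw [Units.val_mul, hu, hv]; norm_num))
  · exact mk_eq_mk_of_mk_mul_eq_split u v (mk_eq_splitDiscriminantClassCM_two_of_coords_of_pos hR (by norm_num) (by norm_num)
      disc_not_sq_six_one 40 6 0 5 1 1 one_ne_zero (by norm_num) (by norm_num) (u * v) (by rw [Units.val_mul, hu, hv]; norm_num))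

/-- **The 4 rows met by `1 ≤ n ≤ 40` for `E = ℚ(ζ₈) = ℚ(i,√2)` are PAIRWISE DISTINCT**: `[r₁] ≠ [r₂]` for `r₁ < r₂`
in `{1, 7, 23, 31}` — each by an obstruction certificate for the product `r₁r₂` (`[r₁r₂] ≠ [1] ⇒ [r₁] ≠ [r₂]`; local
obstruction at an inert / ramified / degree-one place, gens 46–48 lemmas). [cite: Deligne1982HodgeCycles, §4 p. 30
(1) and Cor. 4.2] -/
theorem zeta8_reps_pairwise_ne (r₁ r₂ : ℕ) (h₁ : r₁ ∈ ({1, 7, 23, 31} : Finset ℕ))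
    (h₂ : r₂ ∈ ({1, 7, 23, 31} : Finset ℕ)) (hlt : r₁ < r₂)
    (u v : (realField R)ˣ) (hu : (u : realField R) = r₁) (hv : (v : realField R) = r₂) :
    (QuotientGroup.mk u : cmNormResidueGroup R) ≠ QuotientGroup.mk v := by
  haveI := fact_irreducible_cmPolyQ_of_pos hR (by norm_num) (by norm_num) disc_not_sq_six_one
  simp only [Finset.mem_insert, Finset.mem_singleton] at h₁ h₂
  rcases h₁ with rfl | rfl | rfl | rfl <;> rcases h₂ with rfl | rfl | rfl | rfl <;> try omega
  · exact mk_ne_mk_of_mk_mul_ne_split u v (zeta8_mk_seven_mul_ne_splitDiscriminantClassCM hR 1 (by norm_num) (u * v) (by rw [Units.val_mul, hu, hv]; norm_num))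
  · exact mk_ne_mk_of_mk_mul_ne_split u v (zeta8_mk_twentyThree_mul_ne_splitDiscriminantClassCM hR 1 (by norm_num) (u * v) (by rw [Units.val_mul, hu, hv]; norm_num))
  · exact mk_ne_mk_of_mk_mul_ne_split u v (zeta8_mk_thirtyOne_mul_ne_splitDiscriminantClassCM hR 1 (by norm_num) (u * v) (by rw [Units.val_mul, hu, hv]; norm_num))
  · exact mk_ne_mk_of_mk_mul_ne_split u v (zeta8_mk_seven_mul_ne_splitDiscriminantClassCM hR 23 (by norm_num) (u * v) (by rw [Units.val_mul, hu, hv]; norm_num))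
  · exact mk_ne_mk_of_mk_mul_ne_split u v (zeta8_mk_seven_mul_ne_splitDiscriminantClassCM hR 31 (by norm_num) (u * v) (by rw [Units.val_mul, hu, hv]; norm_num))
  · exact mk_ne_mk_of_mk_mul_ne_split u v (zeta8_mk_twentyThree_mul_ne_splitDiscriminantClassCM hR 31 (by norm_num) (u * v) (by rw [Units.val_mul, hu, hv]; norm_num))

/-- **ROW STRUCTURE of the integer classes `1 ≤ n ≤ 40` for `E = ℚ(ζ₈) = ℚ(i,√2)`** (`R = S² + 6S + 1`): `[n₁] =
[n₂]` in `F^×/Nm_{E/F}(E^×)` — the discriminant classes `n₁`, `n₂` label the SAME component `W8.E.δ` of the census —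
**iff `r(n₁) = r(n₂)`**, `r` the row map above; so these 40 classes lie on exactly 4 components, with least labels
`[1, 7, 23, 31]`. [cite: Deligne1982HodgeCycles, §4 p. 30 (1) and Cor. 4.2] [cite: Landherr1936HermitianForms] -/
theorem zeta8_mk_eq_mk_iff_sameRow {n₁ r₁ n₂ r₂ : ℕ}
    (h₁ : (n₁, r₁) ∈ (
      {(1, 1), (2, 1), (3, 1), (4, 1), (5, 1), (6, 1), (7, 7), (8, 1), (9, 1), (10, 1), (11, 1), (12, 1), (13,
       1), (14, 7), (15, 1), (16, 1), (17, 1), (18, 1), (19, 1), (20, 1), (21, 7), (22, 1), (23, 23), (24, 1),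
       (25, 1), (26, 1), (27, 1), (28, 7), (29, 1), (30, 1), (31, 31), (32, 1), (33, 1), (34, 1), (35, 7),
       (36, 1), (37, 1), (38, 1), (39, 1), (40, 1)} : Finset (ℕ × ℕ)))
    (h₂ : (n₂, r₂) ∈ (
      {(1, 1), (2, 1), (3, 1), (4, 1), (5, 1), (6, 1), (7, 7), (8, 1), (9, 1), (10, 1), (11, 1), (12, 1), (13,
       1), (14, 7), (15, 1), (16, 1), (17, 1), (18, 1), (19, 1), (20, 1), (21, 7), (22, 1), (23, 23), (24, 1),
       (25, 1), (26, 1), (27, 1), (28, 7), (29, 1), (30, 1), (31, 31), (32, 1), (33, 1), (34, 1), (35, 7),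
       (36, 1), (37, 1), (38, 1), (39, 1), (40, 1)} : Finset (ℕ × ℕ)))
    (u v : (realField R)ˣ) (hu : (u : realField R) = n₁) (hv : (v : realField R) = n₂) :
    (QuotientGroup.mk u : cmNormResidueGroup R) = QuotientGroup.mk v ↔ r₁ = r₂ :=
  mk_eq_mk_iff_of_rowMap _ ({1, 7, 23, 31} : Finset ℕ) (zeta8_rowMap hR) (zeta8_reps_pairwise_ne hR) (by decide)
    h₁ h₂ u v hu hv

end Zeta8

/-! ### `E = ℚ(ζ₁₂) = ℚ(i,√3)`, `R = S² + 8S + 4`: 3 rows among `1 ≤ n ≤ 40` — representatives `[1, 11, 23]` -/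

section Zeta12

variable {R : Polynomial ℤ} (hR : R = X ^ 2 + C 8 * X + C 4) [Fact (Irreducible (realPolyQ R))]
include hR

/-- **ROW MAP for `E = ℚ(ζ₁₂) = ℚ(i,√3)` (`R = S² + 8S + 4`), `1 ≤ n ≤ 40`: `[n] = [r(n)]` in `F^×/Nm_{E/F}(E^×)`,
`r(n)` = the least positive integer on the row of `[n]`** — the displayed set is the graph of `r` (split entries `r
= 1`; non-split rows: [11] ∋ 11, 22, 33; [23] ∋ 23). Each case is a norm witness `(A + Bσ)² - σ(C + Dσ)² =
n·r(n)·m²` (`[n·r(n)] = [1] ⇒ [n] = [r(n)]`), or `u = v`. Agrees with the `T`-sets of census §b03.5 (PARI + stdlib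
×2 + ring2-b06's third code). [cite: Deligne1982HodgeCycles, §4 p. 30 (1) and Cor. 4.2] -/
theorem zeta12_rowMap (n r : ℕ)
    (h : (n, r) ∈ (
      {(1, 1), (2, 1), (3, 1), (4, 1), (5, 1), (6, 1), (7, 1), (8, 1), (9, 1), (10, 1), (11, 11), (12, 1),
       (13, 1), (14, 1), (15, 1), (16, 1), (17, 1), (18, 1), (19, 1), (20, 1), (21, 1), (22, 11), (23, 23),
       (24, 1), (25, 1), (26, 1), (27, 1), (28, 1), (29, 1), (30, 1), (31, 1), (32, 1), (33, 11), (34, 1),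
       (35, 1), (36, 1), (37, 1), (38, 1), (39, 1), (40, 1)} : Finset (ℕ × ℕ)))
    (u v : (realField R)ˣ) (hu : (u : realField R) = n) (hv : (v : realField R) = r) :
    (QuotientGroup.mk u : cmNormResidueGroup R) = QuotientGroup.mk v := by
  haveI := fact_irreducible_cmPolyQ_of_pos hR (by norm_num) (by norm_num) disc_not_sq_eight_four
  simp only [Finset.mem_insert, Finset.mem_singleton, Prod.mk.injEq] at h
  rcases h with ⟨rfl, rfl⟩ | ⟨rfl, rfl⟩ | ⟨rfl, rfl⟩ | ⟨rfl, rfl⟩ | ⟨rfl, rfl⟩ | ⟨rfl, rfl⟩ | ⟨rfl, rfl⟩ | ⟨rfl, rfl⟩ | ⟨rfl, rfl⟩ | ⟨rfl, rfl⟩ |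
    ⟨rfl, rfl⟩ | ⟨rfl, rfl⟩ | ⟨rfl, rfl⟩ | ⟨rfl, rfl⟩ | ⟨rfl, rfl⟩ | ⟨rfl, rfl⟩ | ⟨rfl, rfl⟩ | ⟨rfl, rfl⟩ | ⟨rfl, rfl⟩ | ⟨rfl, rfl⟩ |
    ⟨rfl, rfl⟩ | ⟨rfl, rfl⟩ | ⟨rfl, rfl⟩ | ⟨rfl, rfl⟩ | ⟨rfl, rfl⟩ | ⟨rfl, rfl⟩ | ⟨rfl, rfl⟩ | ⟨rfl, rfl⟩ | ⟨rfl, rfl⟩ | ⟨rfl, rfl⟩ |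
    ⟨rfl, rfl⟩ | ⟨rfl, rfl⟩ | ⟨rfl, rfl⟩ | ⟨rfl, rfl⟩ | ⟨rfl, rfl⟩ | ⟨rfl, rfl⟩ | ⟨rfl, rfl⟩ | ⟨rfl, rfl⟩ | ⟨rfl, rfl⟩ | ⟨rfl, rfl⟩
  · rw [Units.ext (hu.trans hv.symm : (u : realField R) = v)]
  · exact mk_eq_mk_of_mk_mul_eq_split u v (mk_eq_splitDiscriminantClassCM_two_of_coords_of_pos hR (by norm_num) (by norm_num)
      disc_not_sq_eight_four 2 6 1 2 0 4 four_ne_zero (by norm_num) (by norm_num) (u * v) (by rw [Units.val_mul, hu, hv]; norm_num))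
  · exact mk_eq_mk_of_mk_mul_eq_split u v (mk_eq_splitDiscriminantClassCM_two_of_coords_of_pos hR (by norm_num) (by norm_num)
      disc_not_sq_eight_four 3 4 1 0 0 2 two_ne_zero (by norm_num) (by norm_num) (u * v) (by rw [Units.val_mul, hu, hv]; norm_num))
  · exact mk_eq_mk_of_mk_mul_eq_split u v (mk_eq_splitDiscriminantClassCM_two_of_coords_of_pos hR (by norm_num) (by norm_num)
      disc_not_sq_eight_four 4 2 0 0 0 1 one_ne_zero (by norm_num) (by norm_num) (u * v) (by rw [Units.val_mul, hu, hv]; norm_num))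
  · exact mk_eq_mk_of_mk_mul_eq_split u v (mk_eq_splitDiscriminantClassCM_two_of_coords_of_pos hR (by norm_num) (by norm_num)
      disc_not_sq_eight_four 5 2 0 6 1 2 two_ne_zero (by norm_num) (by norm_num) (u * v) (by rw [Units.val_mul, hu, hv]; norm_num))
  · exact mk_eq_mk_of_mk_mul_eq_split u v (mk_eq_splitDiscriminantClassCM_two_of_coords_of_pos hR (by norm_num) (by norm_num)
      disc_not_sq_eight_four 6 10 1 4 1 4 four_ne_zero (by norm_num) (by norm_num) (u * v) (by rw [Units.val_mul, hu, hv]; norm_num))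
  · exact mk_eq_mk_of_mk_mul_eq_split u v (mk_eq_splitDiscriminantClassCM_two_of_coords_of_pos hR (by norm_num) (by norm_num)
      disc_not_sq_eight_four 7 4 1 6 1 2 two_ne_zero (by norm_num) (by norm_num) (u * v) (by rw [Units.val_mul, hu, hv]; norm_num))
  · exact mk_eq_mk_of_mk_mul_eq_split u v (mk_eq_splitDiscriminantClassCM_two_of_coords_of_pos hR (by norm_num) (by norm_num)
      disc_not_sq_eight_four 8 6 1 2 0 2 two_ne_zero (by norm_num) (by norm_num) (u * v) (by rw [Units.val_mul, hu, hv]; norm_num))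
  · exact mk_eq_mk_of_mk_mul_eq_split u v (mk_eq_splitDiscriminantClassCM_two_of_coords_of_pos hR (by norm_num) (by norm_num)
      disc_not_sq_eight_four 9 3 0 0 0 1 one_ne_zero (by norm_num) (by norm_num) (u * v) (by rw [Units.val_mul, hu, hv]; norm_num))
  · exact mk_eq_mk_of_mk_mul_eq_split u v (mk_eq_splitDiscriminantClassCM_two_of_coords_of_pos hR (by norm_num) (by norm_num)
      disc_not_sq_eight_four 10 12 0 6 1 4 four_ne_zero (by norm_num) (by norm_num) (u * v) (by rw [Units.val_mul, hu, hv]; norm_num))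
  · rw [Units.ext (hu.trans hv.symm : (u : realField R) = v)]
  · exact mk_eq_mk_of_mk_mul_eq_split u v (mk_eq_splitDiscriminantClassCM_two_of_coords_of_pos hR (by norm_num) (by norm_num)
      disc_not_sq_eight_four 12 4 1 0 0 1 one_ne_zero (by norm_num) (by norm_num) (u * v) (by rw [Units.val_mul, hu, hv]; norm_num))
  · exact mk_eq_mk_of_mk_mul_eq_split u v (mk_eq_splitDiscriminantClassCM_two_of_coords_of_pos hR (by norm_num) (by norm_num)
      disc_not_sq_eight_four 13 6 0 6 1 2 two_ne_zero (by norm_num) (by norm_num) (u * v) (by rw [Units.val_mul, hu, hv]; norm_num))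
  · exact mk_eq_mk_of_mk_mul_eq_split u v (mk_eq_splitDiscriminantClassCM_two_of_coords_of_pos hR (by norm_num) (by norm_num)
      disc_not_sq_eight_four 14 14 1 10 2 4 four_ne_zero (by norm_num) (by norm_num) (u * v) (by rw [Units.val_mul, hu, hv]; norm_num))
  · exact mk_eq_mk_of_mk_mul_eq_split u v (mk_eq_splitDiscriminantClassCM_two_of_coords_of_pos hR (by norm_num) (by norm_num)
      disc_not_sq_eight_four 15 4 1 10 1 2 two_ne_zero (by norm_num) (by norm_num) (u * v) (by rw [Units.val_mul, hu, hv]; norm_num))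
  · exact mk_eq_mk_of_mk_mul_eq_split u v (mk_eq_splitDiscriminantClassCM_two_of_coords_of_pos hR (by norm_num) (by norm_num)
      disc_not_sq_eight_four 16 4 0 0 0 1 one_ne_zero (by norm_num) (by norm_num) (u * v) (by rw [Units.val_mul, hu, hv]; norm_num))
  · exact mk_eq_mk_of_mk_mul_eq_split u v (mk_eq_splitDiscriminantClassCM_two_of_coords_of_pos hR (by norm_num) (by norm_num)
      disc_not_sq_eight_four 17 1 0 6 1 1 one_ne_zero (by norm_num) (by norm_num) (u * v) (by rw [Units.val_mul, hu, hv]; norm_num))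
  · exact mk_eq_mk_of_mk_mul_eq_split u v (mk_eq_splitDiscriminantClassCM_two_of_coords_of_pos hR (by norm_num) (by norm_num)
      disc_not_sq_eight_four 18 18 3 6 0 4 four_ne_zero (by norm_num) (by norm_num) (u * v) (by rw [Units.val_mul, hu, hv]; norm_num))
  · exact mk_eq_mk_of_mk_mul_eq_split u v (mk_eq_splitDiscriminantClassCM_two_of_coords_of_pos hR (by norm_num) (by norm_num)
      disc_not_sq_eight_four 19 4 1 12 2 2 two_ne_zero (by norm_num) (by norm_num) (u * v) (by rw [Units.val_mul, hu, hv]; norm_num))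
  · exact mk_eq_mk_of_mk_mul_eq_split u v (mk_eq_splitDiscriminantClassCM_two_of_coords_of_pos hR (by norm_num) (by norm_num)
      disc_not_sq_eight_four 20 2 0 6 1 1 one_ne_zero (by norm_num) (by norm_num) (u * v) (by rw [Units.val_mul, hu, hv]; norm_num))
  · exact mk_eq_mk_of_mk_mul_eq_split u v (mk_eq_splitDiscriminantClassCM_two_of_coords_of_pos hR (by norm_num) (by norm_num)
      disc_not_sq_eight_four 21 6 0 10 1 2 two_ne_zero (by norm_num) (by norm_num) (u * v) (by rw [Units.val_mul, hu, hv]; norm_num))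
  · exact mk_eq_mk_of_mk_mul_eq_split u v (mk_eq_splitDiscriminantClassCM_two_of_coords_of_pos hR (by norm_num) (by norm_num)
      disc_not_sq_eight_four 242 66 11 22 0 4 four_ne_zero (by norm_num) (by norm_num) (u * v) (by rw [Units.val_mul, hu, hv]; norm_num))
  · rw [Units.ext (hu.trans hv.symm : (u : realField R) = v)]
  · exact mk_eq_mk_of_mk_mul_eq_split u v (mk_eq_splitDiscriminantClassCM_two_of_coords_of_pos hR (by norm_num) (by norm_num)
      disc_not_sq_eight_four 24 10 1 4 1 2 two_ne_zero (by norm_num) (by norm_num) (u * v) (by rw [Units.val_mul, hu, hv]; norm_num))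
  · exact mk_eq_mk_of_mk_mul_eq_split u v (mk_eq_splitDiscriminantClassCM_two_of_coords_of_pos hR (by norm_num) (by norm_num)
      disc_not_sq_eight_four 25 5 0 0 0 1 one_ne_zero (by norm_num) (by norm_num) (u * v) (by rw [Units.val_mul, hu, hv]; norm_num))
  · exact mk_eq_mk_of_mk_mul_eq_split u v (mk_eq_splitDiscriminantClassCM_two_of_coords_of_pos hR (by norm_num) (by norm_num)
      disc_not_sq_eight_four 26 18 1 16 3 4 four_ne_zero (by norm_num) (by norm_num) (u * v) (by rw [Units.val_mul, hu, hv]; norm_num))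
  · exact mk_eq_mk_of_mk_mul_eq_split u v (mk_eq_splitDiscriminantClassCM_two_of_coords_of_pos hR (by norm_num) (by norm_num)
      disc_not_sq_eight_four 27 12 3 0 0 2 two_ne_zero (by norm_num) (by norm_num) (u * v) (by rw [Units.val_mul, hu, hv]; norm_num))
  · exact mk_eq_mk_of_mk_mul_eq_split u v (mk_eq_splitDiscriminantClassCM_two_of_coords_of_pos hR (by norm_num) (by norm_num)
      disc_not_sq_eight_four 28 4 1 6 1 1 one_ne_zero (by norm_num) (by norm_num) (u * v) (by rw [Units.val_mul, hu, hv]; norm_num))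
  · exact mk_eq_mk_of_mk_mul_eq_split u v (mk_eq_splitDiscriminantClassCM_two_of_coords_of_pos hR (by norm_num) (by norm_num)
      disc_not_sq_eight_four 29 10 0 6 1 2 two_ne_zero (by norm_num) (by norm_num) (u * v) (by rw [Units.val_mul, hu, hv]; norm_num))
  · exact mk_eq_mk_of_mk_mul_eq_split u v (mk_eq_splitDiscriminantClassCM_two_of_coords_of_pos hR (by norm_num) (by norm_num)
      disc_not_sq_eight_four 30 22 1 6 0 4 four_ne_zero (by norm_num) (by norm_num) (u * v) (by rw [Units.val_mul, hu, hv]; norm_num))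
  · exact mk_eq_mk_of_mk_mul_eq_split u v (mk_eq_splitDiscriminantClassCM_two_of_coords_of_pos hR (by norm_num) (by norm_num)
      disc_not_sq_eight_four 31 12 3 6 1 2 two_ne_zero (by norm_num) (by norm_num) (u * v) (by rw [Units.val_mul, hu, hv]; norm_num))
  · exact mk_eq_mk_of_mk_mul_eq_split u v (mk_eq_splitDiscriminantClassCM_two_of_coords_of_pos hR (by norm_num) (by norm_num)
      disc_not_sq_eight_four 32 6 1 2 0 1 one_ne_zero (by norm_num) (by norm_num) (u * v) (by rw [Units.val_mul, hu, hv]; norm_num))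
  · exact mk_eq_mk_of_mk_mul_eq_split u v (mk_eq_splitDiscriminantClassCM_two_of_coords_of_pos hR (by norm_num) (by norm_num)
      disc_not_sq_eight_four 363 44 11 0 0 2 two_ne_zero (by norm_num) (by norm_num) (u * v) (by rw [Units.val_mul, hu, hv]; norm_num))
  · exact mk_eq_mk_of_mk_mul_eq_split u v (mk_eq_splitDiscriminantClassCM_two_of_coords_of_pos hR (by norm_num) (by norm_num)
      disc_not_sq_eight_four 34 20 0 18 3 4 four_ne_zero (by norm_num) (by norm_num) (u * v) (by rw [Units.val_mul, hu, hv]; norm_num))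
  · exact mk_eq_mk_of_mk_mul_eq_split u v (mk_eq_splitDiscriminantClassCM_two_of_coords_of_pos hR (by norm_num) (by norm_num)
      disc_not_sq_eight_four 35 12 1 4 0 2 two_ne_zero (by norm_num) (by norm_num) (u * v) (by rw [Units.val_mul, hu, hv]; norm_num))
  · exact mk_eq_mk_of_mk_mul_eq_split u v (mk_eq_splitDiscriminantClassCM_two_of_coords_of_pos hR (by norm_num) (by norm_num)
      disc_not_sq_eight_four 36 6 0 0 0 1 one_ne_zero (by norm_num) (by norm_num) (u * v) (by rw [Units.val_mul, hu, hv]; norm_num))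
  · exact mk_eq_mk_of_mk_mul_eq_split u v (mk_eq_splitDiscriminantClassCM_two_of_coords_of_pos hR (by norm_num) (by norm_num)
      disc_not_sq_eight_four 37 10 0 10 1 2 two_ne_zero (by norm_num) (by norm_num) (u * v) (by rw [Units.val_mul, hu, hv]; norm_num))
  · exact mk_eq_mk_of_mk_mul_eq_split u v (mk_eq_splitDiscriminantClassCM_two_of_coords_of_pos hR (by norm_num) (by norm_num)
      disc_not_sq_eight_four 38 22 5 22 2 4 four_ne_zero (by norm_num) (by norm_num) (u * v) (by rw [Units.val_mul, hu, hv]; norm_num))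
  · exact mk_eq_mk_of_mk_mul_eq_split u v (mk_eq_splitDiscriminantClassCM_two_of_coords_of_pos hR (by norm_num) (by norm_num)
      disc_not_sq_eight_four 39 12 3 10 1 2 two_ne_zero (by norm_num) (by norm_num) (u * v) (by rw [Units.val_mul, hu, hv]; norm_num))
  · exact mk_eq_mk_of_mk_mul_eq_split u v (mk_eq_splitDiscriminantClassCM_two_of_coords_of_pos hR (by norm_num) (by norm_num)
      disc_not_sq_eight_four 40 12 0 6 1 2 two_ne_zero (by norm_num) (by norm_num) (u * v) (by rw [Units.val_mul, hu, hv]; norm_num))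

/-- **The 3 rows met by `1 ≤ n ≤ 40` for `E = ℚ(ζ₁₂) = ℚ(i,√3)` are PAIRWISE DISTINCT**: `[r₁] ≠ [r₂]` for `r₁ < r₂`
in `{1, 11, 23}` — each by an obstruction certificate for the product `r₁r₂` (`[r₁r₂] ≠ [1] ⇒ [r₁] ≠ [r₂]`; local
obstruction at an inert / ramified / degree-one place, gens 46–48 lemmas). [cite: Deligne1982HodgeCycles, §4 p. 30
(1) and Cor. 4.2] -/
theorem zeta12_reps_pairwise_ne (r₁ r₂ : ℕ) (h₁ : r₁ ∈ ({1, 11, 23} : Finset ℕ))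
    (h₂ : r₂ ∈ ({1, 11, 23} : Finset ℕ)) (hlt : r₁ < r₂)
    (u v : (realField R)ˣ) (hu : (u : realField R) = r₁) (hv : (v : realField R) = r₂) :
    (QuotientGroup.mk u : cmNormResidueGroup R) ≠ QuotientGroup.mk v := by
  haveI := fact_irreducible_cmPolyQ_of_pos hR (by norm_num) (by norm_num) disc_not_sq_eight_four
  simp only [Finset.mem_insert, Finset.mem_singleton] at h₁ h₂
  rcases h₁ with rfl | rfl | rfl <;> rcases h₂ with rfl | rfl | rfl <;> try omega
  · exact mk_ne_mk_of_mk_mul_ne_split u v (zeta12_mk_eleven_mul_ne_splitDiscriminantClassCM hR 1 (by norm_num) (u * v) (by rw [Units.val_mul, hu, hv]; norm_num))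
  · exact mk_ne_mk_of_mk_mul_ne_split u v (zeta12_mk_twentyThree_mul_ne_splitDiscriminantClassCM hR 1 (by norm_num) (u * v) (by rw [Units.val_mul, hu, hv]; norm_num))
  · exact mk_ne_mk_of_mk_mul_ne_split u v (zeta12_mk_eleven_mul_ne_splitDiscriminantClassCM hR 23 (by norm_num) (u * v) (by rw [Units.val_mul, hu, hv]; norm_num))

/-- **ROW STRUCTURE of the integer classes `1 ≤ n ≤ 40` for `E = ℚ(ζ₁₂) = ℚ(i,√3)`** (`R = S² + 8S + 4`): `[n₁] =
[n₂]` in `F^×/Nm_{E/F}(E^×)` — the discriminant classes `n₁`, `n₂` label the SAME component `W8.E.δ` of the census —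
**iff `r(n₁) = r(n₂)`**, `r` the row map above; so these 40 classes lie on exactly 3 components, with least labels
`[1, 11, 23]`. [cite: Deligne1982HodgeCycles, §4 p. 30 (1) and Cor. 4.2] [cite: Landherr1936HermitianForms] -/
theorem zeta12_mk_eq_mk_iff_sameRow {n₁ r₁ n₂ r₂ : ℕ}
    (h₁ : (n₁, r₁) ∈ (
      {(1, 1), (2, 1), (3, 1), (4, 1), (5, 1), (6, 1), (7, 1), (8, 1), (9, 1), (10, 1), (11, 11), (12, 1),
       (13, 1), (14, 1), (15, 1), (16, 1), (17, 1), (18, 1), (19, 1), (20, 1), (21, 1), (22, 11), (23, 23),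
       (24, 1), (25, 1), (26, 1), (27, 1), (28, 1), (29, 1), (30, 1), (31, 1), (32, 1), (33, 11), (34, 1),
       (35, 1), (36, 1), (37, 1), (38, 1), (39, 1), (40, 1)} : Finset (ℕ × ℕ)))
    (h₂ : (n₂, r₂) ∈ (
      {(1, 1), (2, 1), (3, 1), (4, 1), (5, 1), (6, 1), (7, 1), (8, 1), (9, 1), (10, 1), (11, 11), (12, 1),
       (13, 1), (14, 1), (15, 1), (16, 1), (17, 1), (18, 1), (19, 1), (20, 1), (21, 1), (22, 11), (23, 23),
       (24, 1), (25, 1), (26, 1), (27, 1), (28, 1), (29, 1), (30, 1), (31, 1), (32, 1), (33, 11), (34, 1),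
       (35, 1), (36, 1), (37, 1), (38, 1), (39, 1), (40, 1)} : Finset (ℕ × ℕ)))
    (u v : (realField R)ˣ) (hu : (u : realField R) = n₁) (hv : (v : realField R) = n₂) :
    (QuotientGroup.mk u : cmNormResidueGroup R) = QuotientGroup.mk v ↔ r₁ = r₂ :=
  mk_eq_mk_iff_of_rowMap _ ({1, 11, 23} : Finset ℕ) (zeta12_rowMap hR) (zeta12_reps_pairwise_ne hR) (by decide)
    h₁ h₂ u v hu hv

end Zeta12

end Summit.HodgeConjecture.HodgeConjecture.Ring2.WeilCoverageCM

end
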